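import Summits.QuantumFields.QCD.Theses.SpectralDefectExtinction
import Literature.MathematicalPhysics.QuantumFieldTheory.QCDPhaseQuenched
import Literature.MathematicalPhysics.QuantumFieldTheory.SpectralDefectDensity
import Literature.Barriers.QuantumFields.WilsonDeterminantMassSplitting

/-!
# Stub `glueHaar` of line `Sketch` (skeleton "ResolventCell") for crux
`SpectralDefectExtinction.WegnerEstimate` (item stmt-QuantumFields-8966)

Pure measure theory (independence of the coordinates of a product measure): for a probability
measure `ν` on `α`, a finite index type `ι` and any `S ⊆ ι`, the *glue map*
`(U, V) ↦ (i ↦ if i ∈ S then V i else U i)`, which takes the coordinates in `S` from the second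
factor and the remaining coordinates from the first, pushes `ν^{⊗ι} ⊗ ν^{⊗ι}` forward to `ν^{⊗ι}`.

Proof: by `Measure.pi_eq` it suffices to check measurable boxes `Set.pi univ s`.  The preimage of
such a box under the glue map is the product of the two boxes with sides
`if i ∈ S then univ else s i` and `if i ∈ S then s i else univ`, whose `ν^{⊗ι} ⊗ ν^{⊗ι}`-measure is
`∏ i, ν(·) * ∏ i, ν(·) = ∏ i, ν (s i)` because `ν univ = 1` (`Measure.prod_prod`, `Measure.pi_pi`).
(Pattern as in `Literature.MathematicalPhysics.QuantumLattice.LatticeGaugeDLRGibbsProofs`,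
`map_piecewise_prod_pi`, which is the `Finset.piecewise` form of the same resampling identity.)
-/

noncomputable section

namespace Summit.QuantumFields.QCD.Cruxes.WegnerEstimate.ResolventCell

open MeasureTheory
open scoped Matrix BigOperators
open Literature.MathematicalPhysics.QuantumLattice Literature.MathematicalPhysics.QuantumFieldTheory
  Literature.Probability.LatticeModels
open Matrix

/-- The glue map `p ↦ (i ↦ if i ∈ S then p.2 i else p.1 i)` on `(ι → α) × (ι → α)` is measurable:
each coordinate is either `p ↦ p.2 i` or `p ↦ p.1 i`. -/
theorem glueHaar_measurable {ι : Type} {α : Type} [MeasurableSpace α] (S : Set ι)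
    [DecidablePred (· ∈ S)] :
    Measurable fun p : (ι → α) × (ι → α) => fun i => if i ∈ S then p.2 i else p.1 i := by
  refine measurable_pi_iff.2 fun i => ?_
  by_cases hi : i ∈ S
  · simp only [if_pos hi]
    exact (measurable_pi_apply i).comp measurable_snd
  · simp only [if_neg hi]
    exact (measurable_pi_apply i).comp measurable_fst

/-- The preimage of a box `Set.pi univ s` under the glue map is the product of the box with sides
`if i ∈ S then univ else s i` (first factor) and the box with sides `if i ∈ S then s i else univ`
(second factor). -/
theorem glueHaar_preimage_univ_pi {ι : Type} {α : Type} (S : Set ι) [DecidablePred (· ∈ S)]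
    (s : ι → Set α) :
    (fun p : (ι → α) × (ι → α) => fun i => if i ∈ S then p.2 i else p.1 i) ⁻¹' Set.univ.pi s =
      (Set.univ.pi fun i => if i ∈ S then Set.univ else s i) ×ˢ
        (Set.univ.pi fun i => if i ∈ S then s i else Set.univ) := by
  ext p
  simp only [Set.mem_preimage, Set.mem_prod, Set.mem_univ_pi]
  constructor
  · intro h
    refine ⟨fun i => ?_, fun i => ?_⟩
    · by_cases hi : i ∈ S
      · simp [hi]
      · simpa [hi] using h i
    · by_cases hi : i ∈ S
      · simpa [hi] using h i
      · simp [hi]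
  · rintro ⟨h₁, h₂⟩ i
    by_cases hi : i ∈ S
    · simpa [hi] using h₂ i
    · simpa [hi] using h₁ i

/-- **Stub `glueHaar` (pure measure theory: independence of the links).**  For a probability measure `ν`
and a finite index type `ι`, the map selecting the coordinates in `S` from the second factor and the other
coordinates from the first pushes `ν^{⊗ι} ⊗ ν^{⊗ι}` forward to `ν^{⊗ι}` (checked on measurable boxes with
`Measure.pi_eq`, `Measure.prod_prod`, `Measure.pi_pi`, using `ν univ = 1`). -/
theorem stub_glueHaar {ι : Type} [Fintype ι] [DecidableEq ι] {α : Type} [MeasurableSpace α]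
    (ν : Measure α) [IsProbabilityMeasure ν] (S : Set ι) [DecidablePred (· ∈ S)] :
    ((Measure.pi fun _ : ι => ν).prod (Measure.pi fun _ : ι => ν)).map
        (fun p : (ι → α) × (ι → α) => fun i => if i ∈ S then p.2 i else p.1 i) =
      Measure.pi fun _ : ι => ν := by
  symm
  refine Measure.pi_eq fun s hs => ?_
  rw [Measure.map_apply (glueHaar_measurable S) (MeasurableSet.univ_pi hs),
    glueHaar_preimage_univ_pi, Measure.prod_prod, Measure.pi_pi, Measure.pi_pi,
    ← Finset.prod_mul_distrib]
  refine Finset.prod_congr rfl fun i _ => ?_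
  by_cases hi : i ∈ S
  · simp [hi]
  · simp [hi]

end Summit.QuantumFields.QCD.Cruxes.WegnerEstimate.ResolventCell
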